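/-
Copyright (c) 2026 the pub-hodgecm-mathlib formalisation cell (harness21).  Prover seat hodgecm-mathlib-K2E1-p10 (g0), Track B ∕ K2-LIT, h413 = `stmt-HodgeConjecture-24833`,
line `K2_E1_TraceFormulaBeta`, campaign «EIS-WHITTAKER-3», WAVE 2 «W3₃ FILE B», brick B-inert (window half): the inert local Whittaker factor on `(Fin 3 → F, μ³)` for EVERY
frequency — holomorphy on `{1 < Re z}`, the `q`-uniform bound, the support in the frequencies, and the per-place PACKAGE in the token currency (the inert hypothesis of ★ C2₃-A).
-/
import Summits.HodgeConjecture.HodgeConjecture.Theorems.K2E1WhittakerLocalMeanInertU3       -- ★ B-inert (this seat): integrability, Fubini, unit value, trivial bound on `(Fin 3 → F, μ³)`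
import Summits.HodgeConjecture.HodgeConjecture.Theorems.K2E1FiniteWhittakerSplitU3Support   -- ★ D-W4 FILE D (this seat): `max_one_coe_normAbs_add_of_mem` (the `𝒪`-shift invariance of `max(1,‖·‖)`)
import Literature.Analysis.Complex.HolomorphicParametricIntegral                         -- ★ `differentiableOn_integral_of_dominated`
import HarnessLib

/-!
# K2·E1 — `K2E1WhittakerLocalMeanInertU3Window` («W3₃ FILE B», brick B-inert, window half): `z ↦ ∫ W^{−2z}ψ₁ψ₂ dμ³` IS HOLOMORPHIC ON `{1 < Re z}`, BOUNDED UNIFORMLY IN `q, ξ, ψ` ON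
# `Re z ≥ σ₁ > 1`, AND VANISHES UNLESS `ξ₁ ∈ 𝔭^{m₁}`, `ξ₂ ∈ 𝔭^{m₂}`; THE INERT PACKAGE `∃ W^c` IN THE TOKEN CURRENCY

Track B ∕ K2-LIT, crux h413 = `stmt-HodgeConjecture-24833`, route of record `HCCMUnconditional`; cell `hodgecm-mathlib`, squad K2, ENGINE E1 (campaign «EIS-WHITTAKER-3», WAVE 2).
THEOREMS ONLY (no `def`, no `instance`, no notation, no named-fact hypothesis, no `sorry`; default heartbeats); lane `--supports stmt-HodgeConjecture-24833 --as helper` (count-neutral).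
Currency of ★ B-inert `K2E1WhittakerLocalMeanInertU3`: non-archimedean local field `F` (`= L⁺_v`, `v` inert unramified), Haar `μ`, `Measure.pi (fun _ : Fin 3 => μ)`, weight
`W(q) = max(1, max(‖q₀‖,‖q₁‖)², ‖q₂‖)` to the power `−2z`, characters `ψ₁(q₀ξ₁)·ψ₂(q₁ξ₂)` (continuous, conductor exponents `m₁, m₂`).
* §1 HOLOMORPHY **`differentiableOn_integral_whittakerInertCell_pi`** on `{1 < Re z}` (dominated holomorphy on `(Fin 3 → F, μ³)`: integrand entire in `z`, majorant the ★ (3-i) integrand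
  at `σ₀ = Re z₀ − R` on `B(z₀,R)`, `R = (Re z₀ − 1)∕2`; NOT claimed entire).
* §2 THE `q`-UNIFORM BOUND: the ★ (3-i) local mean `(1−q^{−2σ})(1+q^{−(2σ−1)})∕[(1−q^{−(2σ−2)})(1+q^{−(2σ−2)})] ≤ 2·(1 − 2^{−(2σ₁−2)})⁻¹` for `σ ≥ σ₁ > 1`, `q ≥ 2`; hence
  `‖μ(𝒪)⁻³·∫ W^{−2z}ψ₁ψ₂ dμ³‖ ≤ 2(1 − 2^{−(2σ₁−2)})⁻¹` on `Re z ≥ σ₁` for EVERY `ξ, ψ` — the constant ★ C2₃-A multiplies over the inert places of `S(ξ)`.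
* §3 SUPPORT (every `z`): `ξ₁ ∉ 𝔭^{m₁} ⟹ ∫ = 0` (translate `q₀ ↦ q₀ + c`, `c ∈ 𝒪`: `W` is invariant, the integral picks up `ψ₁(cξ₁) ≠ 1`), and the same in `q₁, ξ₂`.
* §4 THE PACKAGE **`exists_window_inertWhittakerPackage_pi`**: `∃ W^c` holomorphic on `{1 < Re z}` with `μ(𝒪)⁻³·∫ = W^c(z)` on the window, unit value `(1−q^{−2z})(1+q^{−(2z−1)})` at frequencies
  of level zero (★ B-inert), the `q`-uniform bound, the support — the INERT twin of ★ `K2E1WhittakerLocalMeanSplitU3.exists_window_splitWhittakerPackage_pi`.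
SAT-WITNESS: nothing is quantified over a structure.
HONEST LABEL: HC_CM is proved only modulo the 7 printed citations (2 remaining named inputs: hLiu418 = `stmt-HodgeConjecture-24832`, h413 = `stmt-HodgeConjecture-24833`)
until rung 0 closes; this file asserts no named fact and closes no socket; count-neutral.
References: [Casselman1980] §3, Thm. 3.1 · [CasselmanShalika1980] Thm. 5.4 · [TateThesis1967] Ch. XV §3.3 · [JacquetLanglands1970] §3.
-/

set_option autoImplicit false
-- the mandated namespace repeats the single-problem summit's segment (`HodgeConjecture.HodgeConjecture`)
set_option linter.dupNamespace false

noncomputable section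

open MeasureTheory MeasureTheory.Measure Filter Topology Set TopologicalSpace
open scoped NNReal ENNReal
open Literature.NumberTheory.GaloisRepresentations Literature.NumberTheory.GaloisRepresentations.IsNonarchimedeanLocalField
open Literature.NumberTheory.Automorphic Literature.NumberTheory.Automorphic.LocalFieldHaar
open Summit.HodgeConjecture.HodgeConjecture.Cruxes.HLiu418.K2LiuGKRankOneIntegral
open Summit.HodgeConjecture.HodgeConjecture.Cruxes.H413.K2E1FiniteWhittakerSplitU3Inner (coe_normAbs_le_one_of_mem)
open Summit.HodgeConjecture.HodgeConjecture.Cruxes.H413.K2E1FiniteWhittakerSplitU3Support (max_one_coe_normAbs_add_of_mem)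
open Summit.HodgeConjecture.HodgeConjecture.Cruxes.H413.K2E1IntertwiningLocalMeanInertU3 (integrable_inertCell_pi integral_inertCell_pi_eq)
open Summit.HodgeConjecture.HodgeConjecture.Cruxes.H413.K2E1IntertwiningLocalFactorU3 (max_one_sq_eq)
open Summit.HodgeConjecture.HodgeConjecture.Cruxes.H413.K2E1WhittakerLocalMeanInertU3

namespace Summit.HodgeConjecture.HodgeConjecture.Cruxes.H413.K2E1WhittakerLocalMeanInertU3Window

variable {F : Type*} [Field F] [ValuativeRel F] [TopologicalSpace F] [IsNonarchimedeanLocalField F]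
variable [MeasurableSpace F] [BorelSpace F] (μ : Measure F) [μ.IsAddHaarMeasure]

/-! ## §1  Holomorphy on the window -/

/-- **HOLOMORPHY ON `{1 < Re z}`** (every continuous `ψ₁ ψ₂`, every `ξ₁ ξ₂`): `z ↦ ∫ W(q)^{−2z}ψ₁(q₀ξ₁)ψ₂(q₁ξ₂) dμ³` is holomorphic on the window — ★ `differentiableOn_integral_of_dominated` on
`(Fin 3 → F, μ³)`, majorant the ★ (3-i) integrand at `σ₀ = Re z₀ − R`, `R = (Re z₀ − 1)∕2`. [cite: Casselman1980, §3 Thm. 3.1] [cite: TateThesis1967, §3.3] -/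
theorem differentiableOn_integral_whittakerInertCell_pi {ψ₁ ψ₂ : AddChar F Circle} (hψ₁ : Continuous ψ₁) (hψ₂ : Continuous ψ₂) (ξ₁ ξ₂ : F) :
    DifferentiableOn ℂ (fun z : ℂ => ∫ q : Fin 3 → F, ((max 1 (max ((max ((normAbs F (q 0) : ℝ≥0) : ℝ) ((normAbs F (q 1) : ℝ≥0) : ℝ)) ^ 2) ((normAbs F (q 2) : ℝ≥0) : ℝ)) : ℝ) : ℂ) ^ (-(2 * z)) *
        ((ψ₁ (q 0 * ξ₁) : Circle) : ℂ) * ((ψ₂ (q 1 * ξ₂) : Circle) : ℂ) ∂(Measure.pi fun _ : Fin 3 => μ)) {z : ℂ | 1 < z.re} := by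
  haveI := secondCountableTopology_localField F
  haveI := sigmaCompactSpace_of_isNonarchimedeanLocalField F
  refine Literature.Analysis.Complex.differentiableOn_integral_of_dominated
    (fun z _ => (continuous_inertWhittakerIntegrand hψ₁ hψ₂ ξ₁ ξ₂ z).aestronglyMeasurable) (Eventually.of_forall fun q => ?_) fun z₀ hz₀ => ?_
  · have hW : ((max 1 (max ((max ((normAbs F (q 0) : ℝ≥0) : ℝ) ((normAbs F (q 1) : ℝ≥0) : ℝ)) ^ 2) ((normAbs F (q 2) : ℝ≥0) : ℝ)) : ℝ) : ℂ) ≠ 0 := by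
      exact_mod_cast (one_pos.trans_le (le_max_left _ _)).ne'
    exact ((((differentiable_id.const_mul (2 : ℂ)).neg.const_cpow (Or.inl hW)).mul_const _).mul_const _).differentiableOn
  · have hz₀' : 1 < z₀.re := hz₀
    set R : ℝ := (z₀.re - 1) / 2 with hR
    have hR0 : 0 < R := by rw [hR]; linarith
    have hσ₀ : 1 < z₀.re - R := by rw [hR]; linarith
    have hball : ∀ z ∈ Metric.ball z₀ R, z₀.re - R ≤ z.re := fun z hz => by
      have h1 : |z.re - z₀.re| ≤ ‖z - z₀‖ := by simpa [Complex.sub_re] using Complex.abs_re_le_norm (z - z₀)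
      have h2 := abs_le.mp (h1.trans (mem_ball_iff_norm.mp hz).le)
      linarith [h2.1]
    refine ⟨R, hR0, fun z hz => lt_of_lt_of_le hσ₀ (hball z hz), _, integrable_inertCell_pi μ hσ₀, Eventually.of_forall fun q z hz => ?_⟩
    rw [norm_inertWhittakerIntegrand]
    exact Real.rpow_le_rpow_of_exponent_le (le_max_left _ _) (by linarith [hball z hz])

/-! ## §2  The `q`-uniform bound -/

omit [MeasurableSpace F] [BorelSpace F] in
/-- For `q ≥ 2` and `σ ≥ σ₁ > 1`: the inert local mean `(1−q^{−2σ})(1+q^{−(2σ−1)})∕[(1−q^{−(2σ−2)})(1+q^{−(2σ−2)})] ≤ 2·(1 − 2^{−(2σ₁−2)})⁻¹` (numerator `≤ 2`, denominator `≥ 1 − 2^{−(2σ₁−2)}`).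
[folklore] -/
theorem inertScalar_le_uniform {σ₁ σ : ℝ} (hσ₁ : 1 < σ₁) (hσ : σ₁ ≤ σ) :
    (1 - (residueFieldCard F : ℝ) ^ (-(2 * σ))) * (1 + (residueFieldCard F : ℝ) ^ (-(2 * σ - 1))) /
        ((1 - (residueFieldCard F : ℝ) ^ (-(2 * σ - 2))) * (1 + (residueFieldCard F : ℝ) ^ (-(2 * σ - 2)))) ≤ 2 * (1 - (2 : ℝ) ^ (-(2 * σ₁ - 2)))⁻¹ := by
  have hq2 : (2 : ℝ) ≤ residueFieldCard F := by exact_mod_cast (Nat.succ_le_of_lt (one_lt_residueFieldCard F) : 2 ≤ residueFieldCard F)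
  have hq1 : (1 : ℝ) < residueFieldCard F := one_lt_residueFieldCard_real
  have hq0 : (0 : ℝ) < residueFieldCard F := one_pos.trans hq1
  have h2 : (2 : ℝ) ^ (-(2 * σ₁ - 2)) < 1 := Real.rpow_lt_one_of_one_lt_of_neg one_lt_two (by linarith)
  have hc : 0 < 1 - (2 : ℝ) ^ (-(2 * σ₁ - 2)) := by linarith
  have ha : 0 ≤ (residueFieldCard F : ℝ) ^ (-(2 * σ)) := Real.rpow_nonneg hq0.le _
  have hb : (residueFieldCard F : ℝ) ^ (-(2 * σ - 1)) ≤ 1 := Real.rpow_le_one_of_one_le_of_nonpos hq1.le (by linarith)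
  have hd : (residueFieldCard F : ℝ) ^ (-(2 * σ - 2)) ≤ (2 : ℝ) ^ (-(2 * σ₁ - 2)) :=
    (Real.rpow_le_rpow_of_nonpos two_pos hq2 (by linarith)).trans (Real.rpow_le_rpow_of_exponent_le one_le_two (by linarith))
  have hd0 : 0 ≤ (residueFieldCard F : ℝ) ^ (-(2 * σ - 2)) := Real.rpow_nonneg hq0.le _
  have ha1 : (residueFieldCard F : ℝ) ^ (-(2 * σ)) ≤ 1 := Real.rpow_le_one_of_one_le_of_nonpos hq1.le (by linarith)
  have hb0 : 0 ≤ (residueFieldCard F : ℝ) ^ (-(2 * σ - 1)) := Real.rpow_nonneg hq0.le _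
  have hnum : (1 - (residueFieldCard F : ℝ) ^ (-(2 * σ))) * (1 + (residueFieldCard F : ℝ) ^ (-(2 * σ - 1))) ≤ 2 := by
    calc (1 - (residueFieldCard F : ℝ) ^ (-(2 * σ))) * (1 + (residueFieldCard F : ℝ) ^ (-(2 * σ - 1))) ≤ 1 * 2 :=
          mul_le_mul (by linarith) (by linarith) (by linarith) zero_le_one
      _ = 2 := one_mul 2
  have hden : 1 - (2 : ℝ) ^ (-(2 * σ₁ - 2)) ≤ (1 - (residueFieldCard F : ℝ) ^ (-(2 * σ - 2))) * (1 + (residueFieldCard F : ℝ) ^ (-(2 * σ - 2))) := by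
    calc 1 - (2 : ℝ) ^ (-(2 * σ₁ - 2)) = (1 - (2 : ℝ) ^ (-(2 * σ₁ - 2))) * 1 := (mul_one _).symm
      _ ≤ (1 - (residueFieldCard F : ℝ) ^ (-(2 * σ - 2))) * (1 + (residueFieldCard F : ℝ) ^ (-(2 * σ - 2))) :=
          mul_le_mul (by linarith) (by linarith) zero_le_one (by linarith)
  have hden0 : 0 < (1 - (residueFieldCard F : ℝ) ^ (-(2 * σ - 2))) * (1 + (residueFieldCard F : ℝ) ^ (-(2 * σ - 2))) := hc.trans_le hden
  rw [div_le_iff₀ hden0]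
  calc (1 - (residueFieldCard F : ℝ) ^ (-(2 * σ))) * (1 + (residueFieldCard F : ℝ) ^ (-(2 * σ - 1))) ≤ 2 := hnum
    _ = 2 * (1 - (2 : ℝ) ^ (-(2 * σ₁ - 2)))⁻¹ * (1 - (2 : ℝ) ^ (-(2 * σ₁ - 2))) := by rw [mul_assoc, inv_mul_cancel₀ hc.ne', mul_one]
    _ ≤ 2 * (1 - (2 : ℝ) ^ (-(2 * σ₁ - 2)))⁻¹ * ((1 - (residueFieldCard F : ℝ) ^ (-(2 * σ - 2))) * (1 + (residueFieldCard F : ℝ) ^ (-(2 * σ - 2)))) :=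
        mul_le_mul_of_nonneg_left hden (by positivity)

/-- **THE `q`-UNIFORM BOUND ON THE WINDOW** (every continuous `ψ₁ ψ₂`, every `ξ₁ ξ₂`, `Re z ≥ σ₁ > 1`): `‖μ(𝒪)⁻³·∫ W^{−2z}ψ₁ψ₂ dμ³‖ ≤ 2·(1 − 2^{−(2σ₁−2)})⁻¹` (★ B-inert trivial bound + §2).
[cite: Casselman1980, §3 Thm. 3.1] -/
theorem norm_inv_mul_integral_whittakerInertCell_pi_le_uniform {ψ₁ ψ₂ : AddChar F Circle} (hψ₁ : Continuous ψ₁) (hψ₂ : Continuous ψ₂) (ξ₁ ξ₂ : F)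
    {σ₁ : ℝ} (hσ₁ : 1 < σ₁) {z : ℂ} (hz : σ₁ ≤ z.re) :
    ‖((μ.real (primePowBall F 0) : ℂ)⁻¹) ^ 3 *
        ∫ q : Fin 3 → F, ((max 1 (max ((max ((normAbs F (q 0) : ℝ≥0) : ℝ) ((normAbs F (q 1) : ℝ≥0) : ℝ)) ^ 2) ((normAbs F (q 2) : ℝ≥0) : ℝ)) : ℝ) : ℂ) ^ (-(2 * z)) *
          ((ψ₁ (q 0 * ξ₁) : Circle) : ℂ) * ((ψ₂ (q 1 * ξ₂) : Circle) : ℂ) ∂(Measure.pi fun _ : Fin 3 => μ)‖ ≤ 2 * (1 - (2 : ℝ) ^ (-(2 * σ₁ - 2)))⁻¹ := by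
  have hμ0 : 0 < μ.real (primePowBall F 0) := measureReal_primePowBall_pos μ 0
  have hz1 : 1 < z.re := lt_of_lt_of_le hσ₁ hz
  rw [norm_mul, norm_pow, norm_inv, Complex.norm_real, Real.norm_of_nonneg hμ0.le]
  calc (μ.real (primePowBall F 0))⁻¹ ^ 3 * ‖∫ q : Fin 3 → F, ((max 1 (max ((max ((normAbs F (q 0) : ℝ≥0) : ℝ) ((normAbs F (q 1) : ℝ≥0) : ℝ)) ^ 2) ((normAbs F (q 2) : ℝ≥0) : ℝ)) : ℝ) : ℂ) ^ (-(2 * z)) *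
        ((ψ₁ (q 0 * ξ₁) : Circle) : ℂ) * ((ψ₂ (q 1 * ξ₂) : Circle) : ℂ) ∂(Measure.pi fun _ : Fin 3 => μ)‖
      ≤ (μ.real (primePowBall F 0))⁻¹ ^ 3 * (μ.real (primePowBall F 0) ^ 3 *
          ((1 - (residueFieldCard F : ℝ) ^ (-(2 * z.re))) * (1 + (residueFieldCard F : ℝ) ^ (-(2 * z.re - 1))) /
            ((1 - (residueFieldCard F : ℝ) ^ (-(2 * z.re - 2))) * (1 + (residueFieldCard F : ℝ) ^ (-(2 * z.re - 2)))))) :=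
        mul_le_mul_of_nonneg_left (norm_integral_whittakerInertCell_pi_le μ hψ₁ hψ₂ ξ₁ ξ₂ hz1) (by positivity)
    _ = (1 - (residueFieldCard F : ℝ) ^ (-(2 * z.re))) * (1 + (residueFieldCard F : ℝ) ^ (-(2 * z.re - 1))) /
            ((1 - (residueFieldCard F : ℝ) ^ (-(2 * z.re - 2))) * (1 + (residueFieldCard F : ℝ) ^ (-(2 * z.re - 2)))) := by
        rw [← mul_assoc, ← mul_pow, inv_mul_cancel₀ hμ0.ne', one_pow, one_mul]
    _ ≤ 2 * (1 - (2 : ℝ) ^ (-(2 * σ₁ - 2)))⁻¹ := inertScalar_le_uniform hσ₁ hz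

/-! ## §3  Support in the frequencies (every `z`) -/

omit [MeasurableSpace F] [BorelSpace F] in
/-- The inert weight is invariant under `q₀ ↦ q₀ + c`, `c ∈ 𝒪` (`max(1,‖a+c‖) = max(1,‖a‖)`, squares of `max(1,·)`). [folklore] -/
theorem inertWeight_add_left_of_mem {c : F} (hc : c ∈ primePowBall F 0) (a b t : F) :
    max 1 (max ((max ((normAbs F (a + c) : ℝ≥0) : ℝ) ((normAbs F b : ℝ≥0) : ℝ)) ^ 2) ((normAbs F t : ℝ≥0) : ℝ)) =
      max 1 (max ((max ((normAbs F a : ℝ≥0) : ℝ) ((normAbs F b : ℝ≥0) : ℝ)) ^ 2) ((normAbs F t : ℝ≥0) : ℝ)) := by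
  have E : max 1 ((max ((normAbs F (a + c) : ℝ≥0) : ℝ) ((normAbs F b : ℝ≥0) : ℝ)) ^ 2) = max 1 ((max ((normAbs F a : ℝ≥0) : ℝ) ((normAbs F b : ℝ≥0) : ℝ)) ^ 2) := by
    rw [max_one_sq_eq (le_trans (NNReal.coe_nonneg _) (le_max_left _ _)), max_one_sq_eq (le_trans (NNReal.coe_nonneg _) (le_max_left _ _)), ← max_assoc,
      max_one_coe_normAbs_add_of_mem hc, max_assoc]
  rw [← max_assoc, E, max_assoc]

omit [MeasurableSpace F] [BorelSpace F] in
/-- The inert weight is invariant under `q₁ ↦ q₁ + c`, `c ∈ 𝒪`. [folklore] -/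
theorem inertWeight_add_right_of_mem {c : F} (hc : c ∈ primePowBall F 0) (a b t : F) :
    max 1 (max ((max ((normAbs F a : ℝ≥0) : ℝ) ((normAbs F (b + c) : ℝ≥0) : ℝ)) ^ 2) ((normAbs F t : ℝ≥0) : ℝ)) =
      max 1 (max ((max ((normAbs F a : ℝ≥0) : ℝ) ((normAbs F b : ℝ≥0) : ℝ)) ^ 2) ((normAbs F t : ℝ≥0) : ℝ)) := by
  rw [max_comm ((normAbs F a : ℝ≥0) : ℝ) ((normAbs F (b + c) : ℝ≥0) : ℝ), inertWeight_add_left_of_mem hc b a t,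
    max_comm ((normAbs F b : ℝ≥0) : ℝ) ((normAbs F a : ℝ≥0) : ℝ)]

/-- **VANISHING OFF THE LATTICE IN `ξ₁`** (every `ψ₂, ξ₂, z`; `ψ₁` of conductor exponent `m₁`): `ξ₁ ∉ 𝔭^{m₁} ⟹ ∫ W^{−2z}ψ₁(q₀ξ₁)ψ₂(q₁ξ₂) dμ³ = 0` — translate `q ↦ q + c·e₀` by a
`c ∈ 𝒪` with `ψ₁(cξ₁) ≠ 1` (`μ³` is translation invariant, `W` is invariant). [cite: Casselman1980, §3] [cite: JacquetLanglands1970, §3] -/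
theorem integral_whittakerInertCell_pi_eq_zero_of_not_mem_left {ψ₁ : AddChar F Circle} {m₁ : ℤ} (hm₁ : ψ₁.HasConductorExp m₁) (ψ₂ : AddChar F Circle) {ξ₁ : F}
    (hξ₁ : ξ₁ ∉ primePowBall F m₁) (ξ₂ : F) (z : ℂ) :
    ∫ q : Fin 3 → F, ((max 1 (max ((max ((normAbs F (q 0) : ℝ≥0) : ℝ) ((normAbs F (q 1) : ℝ≥0) : ℝ)) ^ 2) ((normAbs F (q 2) : ℝ≥0) : ℝ)) : ℝ) : ℂ) ^ (-(2 * z)) *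
        ((ψ₁ (q 0 * ξ₁) : Circle) : ℂ) * ((ψ₂ (q 1 * ξ₂) : Circle) : ℂ) ∂(Measure.pi fun _ : Fin 3 => μ) = 0 := by
  haveI := secondCountableTopology_localField F
  haveI := sigmaCompactSpace_of_isNonarchimedeanLocalField F
  obtain ⟨c, hc, hne⟩ := exists_mem_primePowBall_addChar_mul_ne_one hm₁ (n := 0) (by rwa [sub_zero])
  have hne' : ((ψ₁ (c * ξ₁) : Circle) : ℂ) ≠ 1 := fun h => hne (Circle.coe_eq_one.1 h)
  set I := ∫ q : Fin 3 → F, ((max 1 (max ((max ((normAbs F (q 0) : ℝ≥0) : ℝ) ((normAbs F (q 1) : ℝ≥0) : ℝ)) ^ 2) ((normAbs F (q 2) : ℝ≥0) : ℝ)) : ℝ) : ℂ) ^ (-(2 * z)) *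
        ((ψ₁ (q 0 * ξ₁) : Circle) : ℂ) * ((ψ₂ (q 1 * ξ₂) : Circle) : ℂ) ∂(Measure.pi fun _ : Fin 3 => μ) with hI
  have key : I = ((ψ₁ (c * ξ₁) : Circle) : ℂ) * I := by
    conv_lhs => rw [hI, ← integral_add_right_eq_self _ (Pi.single (0 : Fin 3) c)]
    rw [hI, ← integral_const_mul]
    refine integral_congr_ae (Eventually.of_forall fun q => ?_)
    simp only [Pi.add_apply, Pi.single_eq_same, Pi.single_eq_of_ne (show (1 : Fin 3) ≠ 0 by decide), Pi.single_eq_of_ne (show (2 : Fin 3) ≠ 0 by decide), add_zero]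
    rw [inertWeight_add_left_of_mem hc, add_mul, AddChar.map_add_eq_mul, Circle.coe_mul]
    ring
  have h : (1 - ((ψ₁ (c * ξ₁) : Circle) : ℂ)) * I = 0 := by rw [sub_mul, one_mul, ← key, sub_self]
  exact (mul_eq_zero.1 h).resolve_left (sub_ne_zero.2 (Ne.symm hne'))

/-- **VANISHING OFF THE LATTICE IN `ξ₂`** (every `ψ₁, ξ₁, z`; `ψ₂` of conductor exponent `m₂`): `ξ₂ ∉ 𝔭^{m₂} ⟹ ∫ W^{−2z}ψ₁(q₀ξ₁)ψ₂(q₁ξ₂) dμ³ = 0`.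
[cite: Casselman1980, §3] [cite: JacquetLanglands1970, §3] -/
theorem integral_whittakerInertCell_pi_eq_zero_of_not_mem_right (ψ₁ : AddChar F Circle) {ψ₂ : AddChar F Circle} {m₂ : ℤ} (hm₂ : ψ₂.HasConductorExp m₂) (ξ₁ : F) {ξ₂ : F}
    (hξ₂ : ξ₂ ∉ primePowBall F m₂) (z : ℂ) :
    ∫ q : Fin 3 → F, ((max 1 (max ((max ((normAbs F (q 0) : ℝ≥0) : ℝ) ((normAbs F (q 1) : ℝ≥0) : ℝ)) ^ 2) ((normAbs F (q 2) : ℝ≥0) : ℝ)) : ℝ) : ℂ) ^ (-(2 * z)) *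
        ((ψ₁ (q 0 * ξ₁) : Circle) : ℂ) * ((ψ₂ (q 1 * ξ₂) : Circle) : ℂ) ∂(Measure.pi fun _ : Fin 3 => μ) = 0 := by
  haveI := secondCountableTopology_localField F
  haveI := sigmaCompactSpace_of_isNonarchimedeanLocalField F
  obtain ⟨c, hc, hne⟩ := exists_mem_primePowBall_addChar_mul_ne_one hm₂ (n := 0) (by rwa [sub_zero])
  have hne' : ((ψ₂ (c * ξ₂) : Circle) : ℂ) ≠ 1 := fun h => hne (Circle.coe_eq_one.1 h)
  set I := ∫ q : Fin 3 → F, ((max 1 (max ((max ((normAbs F (q 0) : ℝ≥0) : ℝ) ((normAbs F (q 1) : ℝ≥0) : ℝ)) ^ 2) ((normAbs F (q 2) : ℝ≥0) : ℝ)) : ℝ) : ℂ) ^ (-(2 * z)) *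
        ((ψ₁ (q 0 * ξ₁) : Circle) : ℂ) * ((ψ₂ (q 1 * ξ₂) : Circle) : ℂ) ∂(Measure.pi fun _ : Fin 3 => μ) with hI
  have key : I = ((ψ₂ (c * ξ₂) : Circle) : ℂ) * I := by
    conv_lhs => rw [hI, ← integral_add_right_eq_self _ (Pi.single (1 : Fin 3) c)]
    rw [hI, ← integral_const_mul]
    refine integral_congr_ae (Eventually.of_forall fun q => ?_)
    simp only [Pi.add_apply, Pi.single_eq_same, Pi.single_eq_of_ne (show (0 : Fin 3) ≠ 1 by decide), Pi.single_eq_of_ne (show (2 : Fin 3) ≠ 1 by decide), add_zero]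
    rw [inertWeight_add_right_of_mem hc, add_mul, AddChar.map_add_eq_mul, Circle.coe_mul]
    ring
  have h : (1 - ((ψ₂ (c * ξ₂) : Circle) : ℂ)) * I = 0 := by rw [sub_mul, one_mul, ← key, sub_self]
  exact (mul_eq_zero.1 h).resolve_left (sub_ne_zero.2 (Ne.symm hne'))

/-! ## §4  The inert package in the token currency -/

/-- **THE INERT-PLACE PACKAGE IN THE TOKEN CURRENCY** (`ψ₁, ψ₂` continuous of conductor exponents `m₁, m₂`, ANY `ξ₁, ξ₂`): there is `W^c : ℂ → ℂ` with (hol) `W^c` holomorphic on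
`{1 < Re z}`; (i) `μ(𝒪)⁻³·∫ W^{−2z}ψ₁ψ₂ dμ³ = W^c(z)` for `1 < Re z`; (unit) `ξᵢ ∈ 𝔭^{mᵢ} ∖ 𝔭^{mᵢ+1} ⟹ W^c(z) = (1 − q^{−2z})(1 + q^{−(2z−1)})` on the window (★ B-inert); (bd′)
`‖W^c(z)‖ ≤ 2(1 − 2^{−(2σ₁−2)})⁻¹` on `Re z ≥ σ₁ > 1` (UNIFORM in `q, ξ, ψ`); (supp) `ξ₁ ∉ 𝔭^{m₁} ∨ ξ₂ ∉ 𝔭^{m₂} ⟹ W^c = 0`.  The INERT hypothesis of ★ C2₃-A `K2E1WhittakerFinitePartU3`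
at a place `v ∉ S`, twin of ★ `exists_window_splitWhittakerPackage_pi`. [cite: CasselmanShalika1980, Thm. 5.4] [cite: Casselman1980, §3 Thm. 3.1] [cite: TateThesis1967, §3.3] -/
theorem exists_window_inertWhittakerPackage_pi {ψ₁ ψ₂ : AddChar F Circle} (hψ₁ : Continuous ψ₁) (hψ₂ : Continuous ψ₂) {m₁ m₂ : ℤ}
    (hm₁ : ψ₁.HasConductorExp m₁) (hm₂ : ψ₂.HasConductorExp m₂) (ξ₁ ξ₂ : F) :
    ∃ Wc : ℂ → ℂ, DifferentiableOn ℂ Wc {z : ℂ | 1 < z.re} ∧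
      (∀ z : ℂ, 1 < z.re → ((μ.real (primePowBall F 0) : ℂ)⁻¹) ^ 3 *
        ∫ q : Fin 3 → F, ((max 1 (max ((max ((normAbs F (q 0) : ℝ≥0) : ℝ) ((normAbs F (q 1) : ℝ≥0) : ℝ)) ^ 2) ((normAbs F (q 2) : ℝ≥0) : ℝ)) : ℝ) : ℂ) ^ (-(2 * z)) *
          ((ψ₁ (q 0 * ξ₁) : Circle) : ℂ) * ((ψ₂ (q 1 * ξ₂) : Circle) : ℂ) ∂(Measure.pi fun _ : Fin 3 => μ) = Wc z) ∧
      (ξ₁ ∈ primePowBall F m₁ → ξ₁ ∉ primePowBall F (m₁ + 1) → ξ₂ ∈ primePowBall F m₂ → ξ₂ ∉ primePowBall F (m₂ + 1) →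
        ∀ z : ℂ, 1 < z.re → Wc z = (1 - (residueFieldCard F : ℂ) ^ (-(2 * z))) * (1 + (residueFieldCard F : ℂ) ^ (-(2 * z - 1)))) ∧
      (∀ σ₁ : ℝ, 1 < σ₁ → ∀ z : ℂ, σ₁ ≤ z.re → ‖Wc z‖ ≤ 2 * (1 - (2 : ℝ) ^ (-(2 * σ₁ - 2)))⁻¹) ∧
      (ξ₁ ∉ primePowBall F m₁ ∨ ξ₂ ∉ primePowBall F m₂ → Wc = 0) := by
  have hμ0 : 0 < μ.real (primePowBall F 0) := measureReal_primePowBall_pos μ 0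
  have hμ0' : ((μ.real (primePowBall F 0) : ℝ) : ℂ) ≠ 0 := by exact_mod_cast hμ0.ne'
  refine ⟨fun z => ((μ.real (primePowBall F 0) : ℂ)⁻¹) ^ 3 *
      ∫ q : Fin 3 → F, ((max 1 (max ((max ((normAbs F (q 0) : ℝ≥0) : ℝ) ((normAbs F (q 1) : ℝ≥0) : ℝ)) ^ 2) ((normAbs F (q 2) : ℝ≥0) : ℝ)) : ℝ) : ℂ) ^ (-(2 * z)) *
        ((ψ₁ (q 0 * ξ₁) : Circle) : ℂ) * ((ψ₂ (q 1 * ξ₂) : Circle) : ℂ) ∂(Measure.pi fun _ : Fin 3 => μ),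
    (differentiableOn_integral_whittakerInertCell_pi μ hψ₁ hψ₂ ξ₁ ξ₂).const_mul _, fun z _ => rfl, fun h₁ h₁' h₂ h₂' z hz => ?_,
    fun σ₁ hσ₁ z hz => norm_inv_mul_integral_whittakerInertCell_pi_le_uniform μ hψ₁ hψ₂ ξ₁ ξ₂ hσ₁ hz, fun h => ?_⟩
  · simp only
    rw [integral_whittakerInertCell_pi_eq μ hψ₁ hψ₂ hm₁ hm₂ h₁ h₁' h₂ h₂' hz, ← mul_assoc, ← mul_pow, inv_mul_cancel₀ hμ0', one_pow, one_mul]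
  · funext z
    simp only [Pi.zero_apply]
    rcases h with h | h
    · rw [integral_whittakerInertCell_pi_eq_zero_of_not_mem_left μ hm₁ ψ₂ h ξ₂ z, mul_zero]
    · rw [integral_whittakerInertCell_pi_eq_zero_of_not_mem_right μ ψ₁ hm₂ ξ₁ h z, mul_zero]

end Summit.HodgeConjecture.HodgeConjecture.Cruxes.H413.K2E1WhittakerLocalMeanInertU3Window

end
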